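/-
Copyright: the b2b-balaban T⁴-continuum CRUX team, row NE7b OWNER lineage `t4-ne7b-p1` (gen 140). Project licence.
-/
import Summits.QuantumFields.BalabanUV.T4Continuum.Spine.NE7b.SupBlockHessianKernelAverage

/-!
# THE AVERAGE PIECE OF `∂³W`'S KERNEL LETTER: TILTED AVERAGING KEEPS THE THIRD ROW LETTER (SCOPING (d12)(1)(i)).  In the cumulant form
# `∂³W = ⟨U‴⟩ − ΣCov(U″,U′) + κ₃` the first term is the tilted average `Z(ψ)⁻¹∫e^{−U(ω+ψ)}U‴(ω+ψ)[e_x,e_y,e_z]dN(0,Γ)(ω)` of the input's third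
# kernel; (437)'s weighted-average lemma on the PAIR index `(y,z) ∈ ι × ι` gives, for any `Γ ⪰ 0` under the regulator and `‖U‴‖ ≤ κ₃`,
#   `Σ_y Σ_z |⟨U‴⟩_{xyz}(ψ)| ≤ κ₃r`   whenever   `Σ_y Σ_z |U‴(φ)[e_x,e_y,e_z]| ≤ κ₃r` for all `φ, x`
# — the input's third row letter ((433)'s format) passes to the average UNIFORMLY in the background and the volume (row NE7b, node U5c; (437)
# `rowsum_of_weighted_average`, (401), (410) BY NAME; [folklore])

Cell `pub-balaban`, sub-cell `t4`, spine estimate NE7b (`T4WeightBudget.RelWeightBound`; the cell's OWN estimate — NOT PRINTED in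
[Bałaban 1983–89], NOT PROVED).  Crux-route work under `Spine/NE7b/` by the row OWNER (`t4-ne7b-p1` gen 140, file (470)) under FREEZE
(0)'s crux-prover clause; NOTHING of Bałaban's is named as a Lean object, valued or asserted; no `T4Continuum/Support` leaf typed; no
`def`, no notation; zero `sorry`.  Imports (BY NAME): the OWNER's (437) `…SupBlockHessianKernelAverage` (`rowsum_of_weighted_average`;
through it (410) `block_Z_pos`, (401) `integrable_exp_neg_block`, `mul_opBound_le_of_le`).

WHAT IS PROVED ([folklore]; `Γ ⪰ 0` with the operator letter and regulator, `U ∈ C¹`, `U‴ = U₃` continuous with `‖U₃‖ ≤ κ₃`):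
* §1 `third_entry_abs_le` (`|U₃φe_xe_ye_z| ≤ κ₃`), `integrable_weighted_third_entry` (`e^{−U(ω+ψ)}U₃(ω+ψ)[e_x,e_y,e_z] ∈ L¹(N(0,Γ))`).
* §2 `pair_sum_eq` (`Σ_{p ∈ ι×ι} f p.1 p.2 = Σ_yΣ_z f y z`), THE END **`tilted_third_average_rowsum`**.
* §3 toy: none.

HONEST (what this is NOT).  The average piece only; the two-point piece is (469), the cumulant piece (468); the cumulant FORM of `∂³W`
for general `Γ` ((424)∕(425) restated) and the assembly are the successor's.  Scalar skeleton ((A3), NC-NE7b-α UNRULED); nothing of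
Bałaban's asserted.  BY-NAME EFFECT ON THE WALL: NONE.  NE7b NOT PRINTED ∕ NOT PROVED; spine PROVED 0∕9; rung (B)+1 — the programme's
measures remain FINITE-torus statements; NOT the mass gap, NOT Clay.  HONEST DEPENDENCY: continuum YM on T⁴ ⇐ BetaPertH ∧ nine spine
estimates (0∕9 proved); BetaPertH ⇐ (D1) ∧ (D4) ∧ CAP+tail; G-an2-4 gates asym, D1 and NE2∕3∕4.
-/

set_option autoImplicit false
set_option maxSynthPendingDepth 3

noncomputable section

namespace Summit.QuantumFields.BalabanUV.T4Continuum.NE7b.SupBlockThirdKernelAverage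

open MeasureTheory ProbabilityTheory Real Set Function Finset Matrix
open scoped BigOperators
open SupBlockHessianKernelAverage (rowsum_of_weighted_average)
open SupBlockDressedStep (block_Z_pos)
open SupBlockEffectiveActionDerivative (integrable_exp_neg_block)
open SupEffectiveActionDerivative (mul_opBound_le_of_le)

variable {ι : Type} [Fintype ι] [DecidableEq ι]

variable {Γ : Matrix ι ι ℝ} {γop : ℝ} {U : EuclideanSpace ℝ ι → ℝ} {U' : EuclideanSpace ℝ ι → EuclideanSpace ℝ ι →L[ℝ] ℝ}
  {U₃ : EuclideanSpace ℝ ι → EuclideanSpace ℝ ι →L[ℝ] EuclideanSpace ℝ ι →L[ℝ] EuclideanSpace ℝ ι →L[ℝ] ℝ} {κ₀ κ₃ κ₃r τ δ θ : ℝ}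

/-! ## §1. The weighted third entry is integrable -/

/-- `|U₃φ[e_x,e_y,e_z]| ≤ κ₃` from `‖U₃φ‖ ≤ κ₃` (unit vectors). [folklore] -/
theorem third_entry_abs_le (hU₃b : ∀ φ : EuclideanSpace ℝ ι, ‖U₃ φ‖ ≤ κ₃) (φ : EuclideanSpace ℝ ι) (x y z : ι) :
    |U₃ φ (EuclideanSpace.single x (1 : ℝ)) (EuclideanSpace.single y (1 : ℝ)) (EuclideanSpace.single z (1 : ℝ))| ≤ κ₃ := by
  have hx : ‖(EuclideanSpace.single x (1 : ℝ) : EuclideanSpace ℝ ι)‖ = 1 := by simp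
  have hy : ‖(EuclideanSpace.single y (1 : ℝ) : EuclideanSpace ℝ ι)‖ = 1 := by simp
  have hz : ‖(EuclideanSpace.single z (1 : ℝ) : EuclideanSpace ℝ ι)‖ = 1 := by simp
  have h1 := ContinuousLinearMap.le_opNorm (U₃ φ (EuclideanSpace.single x (1 : ℝ)) (EuclideanSpace.single y (1 : ℝ))) (EuclideanSpace.single z (1 : ℝ))
  have h2 := ContinuousLinearMap.le_opNorm (U₃ φ (EuclideanSpace.single x (1 : ℝ))) (EuclideanSpace.single y (1 : ℝ))
  have h3 := ContinuousLinearMap.le_opNorm (U₃ φ) (EuclideanSpace.single x (1 : ℝ))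
  rw [hz, mul_one, Real.norm_eq_abs] at h1
  rw [hy, mul_one] at h2
  rw [hx, mul_one] at h3
  exact h1.trans (h2.trans (h3.trans (hU₃b φ)))

/-- **`e^{−U(ω+ψ)}·U₃(ω+ψ)[e_x,e_y,e_z] ∈ L¹(N(0,Γ))`** under the regulator (bounded × integrable). [folklore] -/
theorem integrable_weighted_third_entry (hΓ : Γ.PosSemidef) (hΓop : (γop • (1 : Matrix ι ι ℝ) - Γ).PosSemidef) (Y : Finset ι)
    (hUd : ∀ φ : EuclideanSpace ℝ ι, HasFDerivAt U (U' φ) φ) (hU₃c : Continuous U₃) (hκ₀ : 0 ≤ κ₀) (hτ : 0 < τ) (hδ : 0 < δ) (hθ0 : 0 < θ)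
    (hθ1 : θ < 1) (hκθ : (2 * κ₀ * (1 + τ) + 4 * δ) * γop ≤ θ) (hstab : ∀ φ : EuclideanSpace ℝ ι, -(κ₀ * ∑ x ∈ Y, φ x ^ 2) ≤ U φ)
    (hU₃b : ∀ φ : EuclideanSpace ℝ ι, ‖U₃ φ‖ ≤ κ₃) (ψ : EuclideanSpace ℝ ι) (x y z : ι) :
    Integrable (fun ω : EuclideanSpace ℝ ι => exp (-U (ω + ψ)) * U₃ (ω + ψ) (EuclideanSpace.single x (1 : ℝ)) (EuclideanSpace.single y (1 : ℝ))
      (EuclideanSpace.single z (1 : ℝ))) (multivariateGaussian 0 Γ) := by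
  have hUc : Continuous U := continuous_iff_continuousAt.2 fun φ => (hUd φ).continuousAt
  have hκθ₀ : 2 * κ₀ * (1 + τ) * γop ≤ θ := mul_opBound_le_of_le (by positivity) (by linarith) hθ0.le hκθ
  have hI := integrable_exp_neg_block hΓ hΓop Y hUc.measurable hκ₀ hτ hθ1 hκθ₀ hstab ψ
  have hsh : Continuous fun ω : EuclideanSpace ℝ ι => ω + ψ := continuous_id.add continuous_const
  have hT : Continuous fun ω : EuclideanSpace ℝ ι => U₃ (ω + ψ) (EuclideanSpace.single x (1 : ℝ)) (EuclideanSpace.single y (1 : ℝ)) (EuclideanSpace.single z (1 : ℝ)) :=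
    (((hU₃c.comp hsh).clm_apply continuous_const).clm_apply continuous_const).clm_apply continuous_const
  refine (hI.mul_const κ₃).mono' ((hI.aestronglyMeasurable.mul hT.aestronglyMeasurable)) (ae_of_all _ fun ω => ?_)
  rw [Real.norm_eq_abs, abs_mul, abs_of_pos (exp_pos _)]
  exact mul_le_mul_of_nonneg_left (third_entry_abs_le hU₃b (ω + ψ) x y z) (exp_pos _).le

/-! ## §2. The average keeps the third row letter -/

omit [DecidableEq ι] in
/-- `Σ_{p ∈ ι×ι} f p.1 p.2 = Σ_y Σ_z f y z`. [folklore] -/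
theorem pair_sum_eq (f : ι → ι → ℝ) : ∑ p : ι × ι, f p.1 p.2 = ∑ y, ∑ z, f y z := by
  rw [← Finset.univ_product_univ, Finset.sum_product]

/-- **TILTED AVERAGING KEEPS THE THIRD ROW LETTER**: `Σ_yΣ_z|⟨U‴⟩_{xyz}(ψ)| ≤ κ₃r` for every background `ψ` and site `x`, for any `Γ ⪰ 0`
under the regulator, whenever `Σ_yΣ_z|U‴(φ)[e_x,e_y,e_z]| ≤ κ₃r` for all `φ, x`. [folklore] -/
theorem tilted_third_average_rowsum (hΓ : Γ.PosSemidef) (hΓop : (γop • (1 : Matrix ι ι ℝ) - Γ).PosSemidef) (Y : Finset ι)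
    (hUd : ∀ φ : EuclideanSpace ℝ ι, HasFDerivAt U (U' φ) φ) (hU₃c : Continuous U₃) (hκ₀ : 0 ≤ κ₀) (hτ : 0 < τ) (hδ : 0 < δ) (hθ0 : 0 < θ)
    (hθ1 : θ < 1) (hκθ : (2 * κ₀ * (1 + τ) + 4 * δ) * γop ≤ θ) (hstab : ∀ φ : EuclideanSpace ℝ ι, -(κ₀ * ∑ x ∈ Y, φ x ^ 2) ≤ U φ)
    (hU₃b : ∀ φ : EuclideanSpace ℝ ι, ‖U₃ φ‖ ≤ κ₃)
    (hU₃row : ∀ (φ : EuclideanSpace ℝ ι) (x : ι), ∑ y, ∑ z, |U₃ φ (EuclideanSpace.single x (1 : ℝ)) (EuclideanSpace.single y (1 : ℝ)) (EuclideanSpace.single z (1 : ℝ))| ≤ κ₃r)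
    (ψ : EuclideanSpace ℝ ι) (x : ι) :
    ∑ y, ∑ z, |(∫ ω : EuclideanSpace ℝ ι, exp (-U (ω + ψ)) ∂(multivariateGaussian 0 Γ))⁻¹ *
        ∫ ω : EuclideanSpace ℝ ι, exp (-U (ω + ψ)) * U₃ (ω + ψ) (EuclideanSpace.single x (1 : ℝ)) (EuclideanSpace.single y (1 : ℝ)) (EuclideanSpace.single z (1 : ℝ))
          ∂(multivariateGaussian 0 Γ)| ≤ κ₃r := by
  have hUc : Continuous U := continuous_iff_continuousAt.2 fun φ => (hUd φ).continuousAt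
  have hκθ₀ : 2 * κ₀ * (1 + τ) * γop ≤ θ := mul_opBound_le_of_le (by positivity) (by linarith) hθ0.le hκθ
  have hI := integrable_exp_neg_block hΓ hΓop Y hUc.measurable hκ₀ hτ hθ1 hκθ₀ hstab ψ
  have hZ := block_Z_pos hΓ hΓop Y hUd hκ₀ hτ hδ hθ0 hθ1 hκθ hstab ψ
  -- (437) on the pair index `ι × ι` (rows read through the first component)
  have h := rowsum_of_weighted_average (multivariateGaussian 0 Γ) (fun ω : EuclideanSpace ℝ ι => exp (-U (ω + ψ)))
    (fun (ω : EuclideanSpace ℝ ι) (q p : ι × ι) => U₃ (ω + ψ) (EuclideanSpace.single q.1 (1 : ℝ)) (EuclideanSpace.single p.1 (1 : ℝ))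
      (EuclideanSpace.single p.2 (1 : ℝ)))
    (fun ω => (exp_pos _).le) hI hZ (fun q p => integrable_weighted_third_entry hΓ hΓop Y hUd hU₃c hκ₀ hτ hδ hθ0 hθ1 hκθ hstab hU₃b ψ q.1 p.1 p.2)
    (fun ω q => by
      rw [pair_sum_eq (fun y z => |U₃ (ω + ψ) (EuclideanSpace.single q.1 (1 : ℝ)) (EuclideanSpace.single y (1 : ℝ)) (EuclideanSpace.single z (1 : ℝ))|)]
      exact hU₃row (ω + ψ) q.1) (x, x)
  rw [pair_sum_eq (fun y z => |(∫ ω : EuclideanSpace ℝ ι, exp (-U (ω + ψ)) ∂(multivariateGaussian 0 Γ))⁻¹ *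
        ∫ ω : EuclideanSpace ℝ ι, exp (-U (ω + ψ)) * U₃ (ω + ψ) (EuclideanSpace.single x (1 : ℝ)) (EuclideanSpace.single y (1 : ℝ)) (EuclideanSpace.single z (1 : ℝ))
          ∂(multivariateGaussian 0 Γ)|)] at h
  exact h

end Summit.QuantumFields.BalabanUV.T4Continuum.NE7b.SupBlockThirdKernelAverage

end
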